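import Summits.ResolutionOfSingularities.ResolutionOfSingularities.Theorems.BranchResolution
import HarnessLib

/-!
# CurveBranchRoot45 — decomp-res lens-4 g45 node «BranchResolution», FILE C (§166): the root with `hF` DISCHARGED

The g44 root consumers (Theorems/CurveBranchRoot §161: `ftt_step_of_g44`, `forcedTowersTerminate_of_g44`, `noForcedTowers_of_g44`
(14 binders), `noForcedTowers_of_g44_residual` (13)) with the located residual `hF : HuggedBranchResolution` in position 2 DELETED
and supplied by the theorem `huggedBranchResolution_holds` (FILE B); every other binder VERBATIM, in order, none re-typed, none
added: `noForcedTowers_of_g45` has 13 binders `hMo hSL hH hP hM hRi h71 hB hC4 hD4 hNP hPu hR`, `_residual` 12.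
NOT a proof of `MaxContactCut.NoForcedTowers` (30253) outright — the 13 remaining hypotheses are untouched (see FILE B, HONEST SCOPE).
[folklore]
-/

noncomputable section

set_option linter.dupNamespace false

open CategoryTheory CategoryTheory.Limits AlgebraicGeometry TopologicalSpace IsLocalRing
open Literature.AlgebraicGeometry.Resolution Scheme.IdealSheafData
open Summit.ResolutionOfSingularities.ResolutionOfSingularities.Theorems
open WeakOrderReduction ForcedTowerClasses DivergentTowerClasses MonomialTowerClasses
open HugDimensionClasses HugDimensionKernels SurfaceShadowClasses SurfaceShadowKernels AbsoluteContactClasses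

namespace Summit.ResolutionOfSingularities.ResolutionOfSingularities.Theorems.HugValuationCut

universe u

variable {k : Type} [Field k]

/-! ## §166 (g45 · ROOT) THE ROOT CONSUMERS WITH `hF : HuggedBranchResolution` DISCHARGED — g44's `noForcedTowers_of_g44`
(Theorems/CurveBranchRoot :184, 14 binders) with position 2 DELETED and supplied by the theorem `huggedBranchResolution_holds`;
the other 13 binders VERBATIM in order (none re-typed, none added). -/

section CurveBranchRoot45

open Summit.ResolutionOfSingularities.ResolutionOfSingularities.Theses

/-- **the weight-`n` step from the g45 cells**: g44's `ftt_step_of_g44` with `hF` := `huggedBranchResolution_holds`;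
nothing else changed. [folklore] -/
theorem ftt_step_of_g45 {n : ℕ} (hn : 1 ≤ n) (hMo : MonomialCorner n) (hSL : SurfaceLaw n)
    (hH : HypersurfaceHuggingTowersTerminate n) (hP : ShadowPort n) (hM : MarkingPort n)
    (hRi : RiderPort n) (h71 : ContactHuggingTowersTerminate n)
    (hB : WildLatentFactorNonThreefoldMixedWallFreeFreshJumpShallowCompanionKangarooTowersTerminate n)
    (hC4 : WildOccultDivisorialNonThreefoldMixedWallFreeFreshJumpShallowCompanionKangarooTowersTerminate n)
    (hD4 : WildOccultNonDivisorialNonThreefoldMixedWallFreeFreshJumpShallowCompanionKangarooTowersTerminate n)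
    (hNP : ContactFreeNonPrincipalInLocusTowersTerminate n) (hPu : PurePrincipalTowersTerminate n)
    (hR : IncommensurableWildDriftingImperfectTowersTerminate n)
    (hlow : ∀ n' : ℕ, 1 ≤ n' → n' < n → ForcedTowersTerminate n') : ForcedTowersTerminate n :=
  ftt_step_of_g44 hn hMo huggedBranchResolution_holds hSL hH hP hM hRi h71 hB hC4 hD4 hNP hPu hR hlow

/-- **`∀ n ≥ 1, ForcedTowersTerminate n`** from the g45 cells (`hF` discharged). [folklore] -/
theorem forcedTowersTerminate_of_g45 (hMo : MaxContactCut.MonomialCornerAll)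
    (hSL : MaxContactCut.SurfaceLawAll) (hH : MaxContactCut.NoHypersurfaceHuggingTowers) (hP : ShadowPortAll)
    (hM : MarkingPortAll) (hRi : RiderPortAll) (h71 : MaxContactCut.NoContactHuggingTowers)
    (hB : NoWildLatentFactorNonThreefoldMixedTowers)
    (hC4 : NoWildOccultDivisorialNonThreefoldMixedTowers) (hD4 : NoWildOccultNonDivisorialNonThreefoldMixedTowers)
    (hNP : NoContactFreeNonPrincipalInLocusTowers) (hPu : NoPurePrincipalTowers) (hR : NoIncommensurableWildDriftingImperfectTowers) :
    ∀ n : ℕ, 1 ≤ n → ForcedTowersTerminate n :=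
  forcedTowersTerminate_of_g44 hMo huggedBranchResolution_holds hSL hH hP hM hRi h71 hB hC4 hD4 hNP hPu hR

/-- **30253 `MaxContactCut.NoForcedTowers` BY NAME from the g45 cells: g44's root consumer `noForcedTowers_of_g44` with its
located residual `hF : HuggedBranchResolution` DISCHARGED by the theorem `huggedBranchResolution_holds` (δ-descent along the
branch) — the other 13 binders verbatim.**  NOT a proof of `MaxContactCut.NoForcedTowers` outright: `hMo hSL hP hM hRi`
(structural), `hH h71` (hugging columns), `hB hC4 hD4` (non-threefold mixed cells) and `hNP hPu hR` (leaves) remain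
hypotheses. [folklore] -/
theorem noForcedTowers_of_g45 (hMo : MaxContactCut.MonomialCornerAll)
    (hSL : MaxContactCut.SurfaceLawAll) (hH : MaxContactCut.NoHypersurfaceHuggingTowers) (hP : ShadowPortAll)
    (hM : MarkingPortAll) (hRi : RiderPortAll) (h71 : MaxContactCut.NoContactHuggingTowers)
    (hB : NoWildLatentFactorNonThreefoldMixedTowers)
    (hC4 : NoWildOccultDivisorialNonThreefoldMixedTowers) (hD4 : NoWildOccultNonDivisorialNonThreefoldMixedTowers)
    (hNP : NoContactFreeNonPrincipalInLocusTowers) (hPu : NoPurePrincipalTowers) (hR : NoIncommensurableWildDriftingImperfectTowers) :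
    MaxContactCut.NoForcedTowers :=
  noForcedTowers_of_g44 hMo huggedBranchResolution_holds hSL hH hP hM hRi h71 hB hC4 hD4 hNP hPu hR

/-- the same from the ABSOLUTE g43 located residual `NoWildOccultNonThreefoldMixedTowers` by name (12 binders). [folklore] -/
theorem noForcedTowers_of_g45_residual (hMo : MaxContactCut.MonomialCornerAll)
    (hSL : MaxContactCut.SurfaceLawAll) (hH : MaxContactCut.NoHypersurfaceHuggingTowers) (hP : ShadowPortAll)
    (hM : MarkingPortAll) (hRi : RiderPortAll) (h71 : MaxContactCut.NoContactHuggingTowers)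
    (hB : NoWildLatentFactorNonThreefoldMixedTowers) (hres : NoWildOccultNonThreefoldMixedTowers)
    (hNP : NoContactFreeNonPrincipalInLocusTowers) (hPu : NoPurePrincipalTowers) (hR : NoIncommensurableWildDriftingImperfectTowers) :
    MaxContactCut.NoForcedTowers :=
  noForcedTowers_of_g45 hMo hSL hH hP hM hRi h71 hB hres.1 hres.2 hNP hPu hR

end CurveBranchRoot45

end Summit.ResolutionOfSingularities.ResolutionOfSingularities.Theorems.HugValuationCut
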